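import Summits.BirchSwinnertonDyer.BirchSwinnertonDyer.Theorems.AdditiveKolyvaginRoadInductionOfLevelSystems
import Summits.BirchSwinnertonDyer.BirchSwinnertonDyer.Theorems.AdditiveKolyvaginRoadKolyvaginPrimitiveAdditiveRankLowering
import Summits.BirchSwinnertonDyer.BirchSwinnertonDyer.Theorems.AdditiveKolyvaginRoadLevelBasics
import Summits.BirchSwinnertonDyer.BirchSwinnertonDyer.Theorems.AdditiveKolyvaginRoadLevelMembership
import HarnessLib

/-!
# Route `AdditiveKolyvaginRoad`, crux `LevelKolyvaginSystemsAdditive` (item stmt-BirchSwinnertonDyer-21396, KS′):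
# THE BOTTOM IS INSIDE THE LEVEL SYSTEM — at a ♯ frame of Selmer rank ONE a level Kolyvagin system already yields
# Kolyvagin primitivity, through `transport` at level `∅` and `baseCase` at the two-prime levels
# (cell `pub/bsd-wall`, lead prover `bsd-wall-akr-p2x` g0, line `birth`; `--supports stmt-BirchSwinnertonDyer-21396`, helper)

WHY. In the parent skeleton (crux r2 `KolyvaginPrimitiveAdditive`, line `birth` v9) the case `#Sel_p(E/K) = p` is served
by the SEPARATE crux BOT′ (`BottomRankOneAdditive`, item 21397: `c(1) ≢ 0 (mod p)`), and KS′ (this crux) only above the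
bottom. This file shows that KS′ ALREADY CARRIES THE BOTTOM, modulo one E-side Poitou–Tate statement (J2): if
`Sel_∅ = Sel_p(E/K)` has `𝔽_p`-dimension one, generated by an `ε`-eigenclass `x`, and `q₁ ≠ q₂` are Bertolini–Darmon
admissible primes BOTH detecting `x` (`loc_{q_i} x ≠ 0`), then (J2) the canonical level-`{q₁,q₂}` space `Sel_{q₁q₂}` has
total dimension one; `baseCase` of the system at the even level `{q₁,q₂}` gives `κ(∅, {q₁,q₂}) ≠ 0`; this class cannot be
locally trivial at both `q₁` and `q₂` (else it would lie in `Sel_∅^{±} = 𝔽_p x ⊕ 0` and `x` would be locally trivial at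
`q₁`); so `q₂` (or `q₁`) is off the base locus of the level and `transport` at level `∅` yields `κ(m, ∅) ≠ 0` for some
Kolyvagin conductor `m` — by `realisation` a non-zero Kolyvagin class `c(∏ m) mod p`, the conclusion of
`KolyvaginPrimitiveAdditive` at the frame. The two detecting primes come from Čebotarev (`Cheb.exists_admissible_loc_ne_zero`,
LANDED). In W. Zhang's terms: Thm 7.2 for the level-raised form `g_{q₁q₂}` plus the congruence Thm 4.3 give Kolyvagin's
conjecture for `E` itself at rank one — the induction's bottom is a level-two instance of the same base case.

CONSEQUENCE FOR THE ROUTE (planner's business, recorded here): granted (J2) — a statement of the same kind as the LANDED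
(A1) `stub_rankLoweringAdditive` and (Supply) (Poitou–Tate for the canonical structures at admissible primes; the
RAISING half of W. Zhang's Lemma 5.3 ∕ Gross–Parson, twice) — the composition `KolyvaginPrimitiveAdditive ⇐ P ∧ KS′ ∧ BOT′`
of skeleton v9 no longer needs BOT′: `KolyvaginPrimitiveAdditive ⇐ P ∧ KS′ ∧ (J2)`.

CONTENTS. §1 bookkeeping (`κ(∅,n) ∈ Sel_n^{ε₀ n}`; a level class locally trivial above the level is a level-`∅` class;
Čebotarev with an arbitrary forbidden set). §2 `exists_kappa_empty_ne_zero_of_pair`: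
the two-prime bottom for ANY `LevelKolyvaginSystemP`. §3 `kolyvaginPrimitive_of_levelSystem_of_rankOne`: at a ♯ additive
frame with `#Sel_p(E/K) = p`, (J2) + a level system ⟹ `∃ n d, KolSupp n ∧ d.kolyvaginClass ≠ 0`.

HONEST FRAMING: theorems only; 0 definitions, 0 named facts, 0 `sorry`; (J2) is an explicit HYPOTHESIS (binder `hJ2`,
Selmer-currency, E-side, not in the tree yet); closes nothing. BSD is not proved by any of this.

References: [cite: WZhang2014, Thm. 4.3, Lemma 5.3, Prop. 5.4, Thm. 7.2, Lemma 7.3, §9] [cite: BertoliniDarmon2005,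
Lemma 2.6, Thm. 3.2] [cite: GrossLMS1991, §4 (4.4)].
-/

-- single-conjunct summit: `Summit.BirchSwinnertonDyer.BirchSwinnertonDyer.…` repeats the name by design
set_option linter.dupNamespace false

noncomputable section

open scoped Classical

namespace Summit.BirchSwinnertonDyer.BirchSwinnertonDyer.Theorems.AdditiveKoly

open WeierstrassCurve NumberField IsDedekindDomain
  Literature.NumberTheory.EllipticCurves Literature.NumberTheory.EllipticCurves.ModularForms
  Literature.NumberTheory.EllipticCurves.Rank1Residual Literature.NumberTheory.GaloisRepresentations Module
  Summit.BirchSwinnertonDyer.Rank1Residual.X11b.Three.Koly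

variable (W : WeierstrassCurve ℚ) (K : Type) [Field K] [NumberField K] (p : ℕ) [W.IsGloballyMinimal]
  (c : K ≃ₐ[ℚ] K) [Module (ZMod p) (Vp W K p)]

/-! ## §1 Bookkeeping -/

/-- **A level-`n` class which is locally TRIVIAL above every prime of `n` is a level-`∅` class** (of the same sign): the
only conditions of `Sel_∅` not already in `Sel_n` are E's Kummer conditions above the primes of `n`, implied by local
triviality (`torsionLocalKer ≤ selmerLocalKer`). [cite: WZhang2014, §5 (Sel_{𝔭_n})] -/
theorem mem_selQP_empty_of_forall_mem_torsionLocalKer {n : Finset (AdmQ W K p)} {μ : Bool} {y : Vp W K p}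
    (hy : y ∈ SelQP W K p c n μ)
    (hloc : ∀ q ∈ n, ∀ v : HeightOneSpectrum (𝓞 K), ((q : ℕ) : 𝓞 K) ∈ v.asIdeal →
      y ∈ (W.baseChange K).torsionLocalKer (v.adicCompletion K) ((p ^ 1 : ℕ) : ℤ)) :
    y ∈ SelQP W K p c ∅ μ := by
  obtain ⟨hsgn, hinf, hfin, -⟩ := (mem_selQP_iff W K p c n μ y).mp hy
  refine (mem_selQP_iff W K p c ∅ μ y).mpr ⟨hsgn, hinf, fun v _ ↦ ?_, fun q hq ↦ absurd hq (Finset.notMem_empty q)⟩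
  by_cases h : ∀ q ∈ n, ((q : ℕ) : 𝓞 K) ∉ v.asIdeal
  · exact hfin v h
  · push Not at h
    obtain ⟨q, hq, hqv⟩ := h
    exact (W.baseChange K).torsionLocalKer_le_selmerLocalKer (v.adicCompletion K) _ (hloc q hq v hqv)

section Cheb

variable [W.IsElliptic] [Fact p.Prime]

/-- **Čebotarev with the sign and an arbitrary forbidden set** (W. Zhang Lemma 7.3 ∕ Bertolini–Darmon Thm. 3.2, LANDED as
`Cheb.exists_admissible_loc_ne_zero`; here in `AdmQ` ∕ `Vp` currency): at an additive `p ≥ 5` with `ρ̄_{E,p}` onto, `K`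
imaginary quadratic Heegner for `N_E`, `c ≠ 1`, a non-zero class of a canonical space `Sel_n^μ` is detected by the
localisation at a place above some admissible `q` outside any given finite set `B`. [cite: WZhang2014, Lemma 7.3]
[cite: BertoliniDarmon2005, Thm. 3.2] -/
theorem exists_admQ_notMem_torsionLocalKer (h5 : 5 ≤ p) (hadd : Addv W p) (hsurj : W.HasSurjectiveModNGaloisRep p)
    (hK : IsImaginaryQuadratic K) (hH : SatisfiesHeegnerHypothesis (W.conductorNorm ℤ) K) (hc1 : c ≠ 1)
    {n : Finset (AdmQ W K p)} {μ : Bool} {x : Vp W K p} (hx : x ∈ SelQP W K p c n μ) (hx0 : x ≠ 0)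
    (B : Finset (AdmQ W K p)) :
    ∃ q : AdmQ W K p, q ∉ B ∧ ∃ v : HeightOneSpectrum (𝓞 K), ((q : ℕ) : 𝓞 K) ∈ v.asIdeal ∧
      x ∉ (W.baseChange K).torsionLocalKer (v.adicCompletion K) ((p ^ 1 : ℕ) : ℤ) := by
  have hp : p.Prime := Fact.out
  haveI : Fact (Nat.Prime (p ^ 1)) := ⟨by rw [pow_one]; exact hp⟩
  have h5' : 5 ≤ p ^ 1 := by rw [pow_one]; exact h5
  have hpN : p ∣ W.conductorNorm ℤ := (W.dvd_conductorNorm_iff_not_hasGoodReductionAtPrime p).mpr hadd.1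
  have hpN' : p ^ 1 ∣ W.conductorNorm ℤ := by rw [pow_one]; exact hpN
  have hsurj' : W.HasSurjectiveModNGaloisRep ((p ^ 1 : ℕ) : ℤ) := by rw [Nat.pow_one]; exact hsurj
  have hν : sgnP μ = 1 ∨ sgnP μ = -1 := by cases μ <;> simp [sgnP]
  have hxν : conjAct W c ((p ^ 1 : ℕ) : ℤ) x = sgnP μ • x := conjAct_eq_of_mem_selQP W K p c n μ hx
  obtain ⟨q, hqB, hadm, v, hqv, hloc⟩ := Cheb.exists_admissible_loc_ne_zero W K (p := p ^ 1) h5' hK hsurj' hpN' hH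
    hc1 hν hx0 hxν (B.image Subtype.val)
  rw [Nat.pow_one] at hadm
  exact ⟨⟨q, hadm⟩, fun hqn ↦ hqB (Finset.mem_image.mpr ⟨⟨q, hadm⟩, hqn, rfl⟩), v, hqv, hloc⟩

end Cheb

section System

variable [W.IsElliptic] [NeZero (W.conductorNorm ℤ)] [Fact p.Prime]
  (Dt : ModularParametrizationData W (W.conductorNorm ℤ)) (β : ℤ) (ι : K →+* ℂ)

omit [W.IsElliptic] in
/-- **The conductor-one class of a level system at a non-empty level lies in the canonical space of that level**:
`κ(∅, n) ∈ Sel_n^{ε₀ n}` (fields `sign` with `#∅` even, `selmer_inf`, `selmer_off`, `toric_on`). [cite: WZhang2014, §8.1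
property (1)] -/
theorem LevelKolyvaginSystemP.kappa_empty_mem_selQP (S : LevelKolyvaginSystemP W K p Dt β ι c)
    (n : Finset (AdmQ W K p)) (hn : n.Nonempty) : S.κ ∅ n ∈ SelQP W K p c n (S.ε₀ n) := by
  refine (mem_selQP_iff W K p c n (S.ε₀ n) _).mpr ⟨?_, S.selmer_inf n hn ∅, fun v hv ↦ ?_, fun q hq v hqv ↦ ?_⟩
  · have h := S.sign n hn ∅
    simpa only [Finset.card_empty, Nat.bodd_zero, Bool.xor_false] using h
  · exact S.selmer_off n hn ∅ v (fun ℓ hℓ ↦ absurd hℓ (Finset.notMem_empty ℓ)) hv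
  · exact S.toric_on n hn ∅ q hq v hqv

/-! ## §2 The two-prime bottom of a level system -/

omit [W.IsElliptic] in
/-- **THE BOTTOM IS INSIDE THE LEVEL SYSTEM.** Let `S` be a level Kolyvagin system. Suppose the level-`∅` canonical
spaces are `Sel_∅^ε = 𝔽_p · x` (every class a multiple of `x`) and `Sel_∅^{¬ε} = 0`; let `q₁ ≠ q₂` be admissible primes,
`x` NOT locally trivial at a place `v₁ ∋ q₁`, and suppose the level `{q₁, q₂}` has total canonical dimension one. Then
some bottom class `κ(m, ∅)` of `S` is non-zero. Proof: `baseCase` at the even non-empty level `{q₁,q₂}` gives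
`y = κ(∅,{q₁,q₂}) ≠ 0`, a class of `Sel_{q₁q₂}^{ε₀}`; were `y` locally trivial above `q₁` and above `q₂` it would lie in
`Sel_∅^{ε₀}`, hence be `0` (sign `¬ε`) or a non-zero multiple of `x` (sign `ε`), making `x` locally trivial at `v₁` —
contradiction; so `q₂` resp. `q₁` is off the base locus of the level and `transport` at level `∅` concludes.
[cite: WZhang2014, Thm. 4.3, Thm. 7.2, §9] -/
theorem LevelKolyvaginSystemP.exists_kappa_empty_ne_zero_of_pair (S : LevelKolyvaginSystemP W K p Dt β ι c)
    {ε : Bool} {x : Vp W K p}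
    (hline : ∀ y ∈ SelQP W K p c ∅ ε, ∃ a : ZMod p, y = a • x) (hbot : SelQP W K p c ∅ (!ε) = ⊥)
    {q₁ q₂ : AdmQ W K p} (hne : q₁ ≠ q₂) {v₁ : HeightOneSpectrum (𝓞 K)} (hv₁ : ((q₁ : ℕ) : 𝓞 K) ∈ v₁.asIdeal)
    (hdet : x ∉ (W.baseChange K).torsionLocalKer (v₁.adicCompletion K) ((p ^ 1 : ℕ) : ℤ))
    (hrank : finrank (ZMod p) (SelQP W K p c {q₁, q₂} true) +
      finrank (ZMod p) (SelQP W K p c {q₁, q₂} false) = 1) :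
    ∃ m, S.κ m ∅ ≠ 0 := by
  -- the level `L = {q₁, q₂}` in the two insertion orders used by `transport`
  have hL : insert q₂ (insert q₁ (∅ : Finset (AdmQ W K p))) = {q₁, q₂} := by
    ext a; simp only [Finset.mem_insert, Finset.notMem_empty, or_false, Finset.mem_singleton]; tauto
  have hL' : insert q₁ (insert q₂ (∅ : Finset (AdmQ W K p))) = {q₁, q₂} := by
    ext a; simp only [Finset.mem_insert, Finset.notMem_empty, or_false, Finset.mem_singleton]
  set L : Finset (AdmQ W K p) := {q₁, q₂} with hLdef
  have hLne : L.Nonempty := ⟨q₁, by simp [hLdef]⟩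
  have hLcard : Even L.card := by
    rw [hLdef, Finset.card_pair hne]
    exact even_two
  -- (A5) at the level: the conductor-one class is non-zero and lies in `Sel_L^{ε₀ L}`
  have hy0 : S.κ ∅ L ≠ 0 := S.baseCase L hLne hLcard hrank
  have hyL : S.κ ∅ L ∈ SelQP W K p c L (S.ε₀ L) := S.kappa_empty_mem_selQP W K p c Dt β ι L hLne
  -- it is NOT locally trivial above both primes of the level
  have hnot : ¬ ∀ q ∈ L, ∀ v : HeightOneSpectrum (𝓞 K), ((q : ℕ) : 𝓞 K) ∈ v.asIdeal →
      S.κ ∅ L ∈ (W.baseChange K).torsionLocalKer (v.adicCompletion K) ((p ^ 1 : ℕ) : ℤ) := by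
    intro hall
    have hyE : S.κ ∅ L ∈ SelQP W K p c ∅ (S.ε₀ L) :=
      mem_selQP_empty_of_forall_mem_torsionLocalKer W K p c hyL hall
    by_cases hε : S.ε₀ L = ε
    · rw [hε] at hyE
      obtain ⟨a, ha⟩ := hline _ hyE
      have ha0 : a ≠ 0 := by
        rintro rfl
        exact hy0 (by rw [ha, zero_smul])
      have hx : x = a⁻¹ • S.κ ∅ L := by rw [ha, smul_smul, inv_mul_cancel₀ ha0, one_smul]
      exact hdet (hx ▸ ZMod.smul_mem (hall q₁ (by simp [hLdef]) v₁ hv₁) a⁻¹)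
    · have hε' : S.ε₀ L = !ε := by cases ε <;> cases h : S.ε₀ L <;> simp_all
      rw [hε', hbot] at hyE
      exact hy0 ((Submodule.mem_bot (R := ZMod p)).mp hyE)
  push Not at hnot
  obtain ⟨q, hqL, v, hqv, hyv⟩ := hnot
  have hq : q = q₁ ∨ q = q₂ := by simpa [hLdef] using hqL
  -- whichever prime it is, it is off the base locus of the level, and `transport` at level `∅` concludes
  rcases hq with rfl | rfl
  · have hoff : q ∉ baseLocusQP W K p S.κ (insert q (insert q₂ ∅)) := by
      rw [hL']
      exact fun h ↦ hyv (h ∅ v hqv)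
    exact S.transport ∅ q₂ q (Finset.notMem_empty _) (by simpa using hne) hoff
  · have hoff : q ∉ baseLocusQP W K p S.κ (insert q (insert q₁ ∅)) := by
      rw [hL]
      exact fun h ↦ hyv (h ∅ v hqv)
    exact S.transport ∅ q₁ q (Finset.notMem_empty _) (by simpa using hne.symm) hoff

/-! ## §3 At a rank-one frame: Kolyvagin primitivity from a level system and (J2) -/

/-- **KOLYVAGIN PRIMITIVITY AT A RANK-ONE ♯ ADDITIVE FRAME FROM A LEVEL KOLYVAGIN SYSTEM, modulo (J2).** At a ♯ additive
frame (`p ≥ 5`, `Addv`, `ρ̄` onto, `K` imaginary quadratic Heegner for `N_E` with `d_K < −4` odd, `4N ∣ β² − d_K`) with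
complex conjugation `c ≠ 1` and `#Sel_p(E/K) = p`: GIVEN (J2) — for an `ε`-eigenclass `x` spanning `Sel_∅^ε` and two
distinct admissible primes `q₁, q₂` both detecting `x`, the level `{q₁, q₂}` has `dim Sel_{q₁q₂}^ε = 1` and
`Sel_{q₁q₂}^{¬ε} = Sel_∅^{¬ε}` (the raising half of W. Zhang's Lemma 5.3 ∕ Prop. 5.4, twice; Poitou–Tate, E-side, NOT
YET IN THE TREE) — every level Kolyvagin system `S` produces a square-free product `n` of Kolyvagin primes and a
Kolyvagin–Heegner datum `d` of conductor `n` with `c_1(n) = d.kolyvaginClass ≠ 0` — the conclusion of crux r2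
`KolyvaginPrimitiveAdditive` at the frame, WITHOUT the bottom crux BOT′. The two detecting primes are supplied by
Čebotarev (`exists_admQ_notMem_torsionLocalKer`). [cite: WZhang2014, Thm. 4.3, Lemma 5.3, Thm. 7.2, Lemma 7.3, §9] -/
theorem kolyvaginPrimitive_of_levelSystem_of_rankOne (h5 : 5 ≤ p) (hadd : Addv W p)
    (hsurj : W.HasSurjectiveModNGaloisRep p) (hK : IsImaginaryQuadratic K)
    (hH : SatisfiesHeegnerHypothesis (W.conductorNorm ℤ) K) (hc1 : c ≠ 1)
    (hJ2 : ∀ (ε : Bool) (x : Vp W K p) (q₁ q₂ : AdmQ W K p) (v₁ v₂ : HeightOneSpectrum (𝓞 K)),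
      x ∈ SelQP W K p c ∅ ε → x ≠ 0 → (∀ y ∈ SelQP W K p c ∅ ε, ∃ a : ZMod p, y = a • x) → q₁ ≠ q₂ →
      ((q₁ : ℕ) : 𝓞 K) ∈ v₁.asIdeal → x ∉ (W.baseChange K).torsionLocalKer (v₁.adicCompletion K) ((p ^ 1 : ℕ) : ℤ) →
      ((q₂ : ℕ) : 𝓞 K) ∈ v₂.asIdeal → x ∉ (W.baseChange K).torsionLocalKer (v₂.adicCompletion K) ((p ^ 1 : ℕ) : ℤ) →
      finrank (ZMod p) (SelQP W K p c {q₁, q₂} ε) = 1 ∧ SelQP W K p c {q₁, q₂} (!ε) = SelQP W K p c ∅ (!ε))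
    (S : LevelKolyvaginSystemP W K p Dt β ι c)
    (hsel : Nat.card (WeierstrassCurve.selmerGroup (W.baseChange K) (p : ℤ)) = p) :
    ∃ (n : ℕ) (d : KolyvaginHeegnerData Dt β ι n),
      KolyvaginDescent.KolSupp (Zhang2014.IsKolyvaginPrime (W.conductorNorm ℤ) W K p) n ∧
        d.kolyvaginClass (Fact.out : p.Prime) 1 ≠ 0 := by
  have hp : p.Prime := Fact.out
  have hp2 : p ≠ 2 := by omega
  have hcc : c * c = 1 := Method2.algEquiv_mul_self_eq_one K hK c
  -- total canonical dimension one at level `∅`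
  have e1 : ((p ^ 1 : ℕ) : ℤ) = (p : ℤ) := by simp
  have hsel' : Nat.card (selmerGroup (W.baseChange K) ((p ^ 1 : ℕ) : ℤ)) = p := by rw [e1]; exact hsel
  have hone : finrank (ZMod p) (SelQP W K p c ∅ true) + finrank (ZMod p) (SelQP W K p c ∅ false) = 1 :=
    (finrank_selQP_empty_add_eq_one_iff W K p hp2 hK c hcc).mpr hsel'
  -- the sign `ε` carrying the line, the other sign trivial
  obtain ⟨ε, hε1, hε0⟩ : ∃ ε : Bool, finrank (ZMod p) (SelQP W K p c ∅ ε) = 1 ∧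
      finrank (ZMod p) (SelQP W K p c ∅ (!ε)) = 0 := by
    rcases Nat.eq_zero_or_pos (finrank (ZMod p) (SelQP W K p c ∅ true)) with h | h
    · refine ⟨false, ?_, ?_⟩
      · omega
      · change finrank (ZMod p) (SelQP W K p c ∅ true) = 0
        exact h
    · refine ⟨true, ?_, ?_⟩
      · omega
      · change finrank (ZMod p) (SelQP W K p c ∅ false) = 0
        omega
  haveI := finiteDimensional_selQP W K p c ∅ (!ε)
  have hbot : SelQP W K p c ∅ (!ε) = ⊥ := Submodule.finrank_eq_zero.mp hε0
  -- a generator `x` of the line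
  obtain ⟨⟨x, hxmem⟩, hx0, hgen⟩ := finrank_eq_one_iff'.mp hε1
  have hx0' : x ≠ 0 := fun h ↦ hx0 (Subtype.ext h)
  have hline : ∀ y ∈ SelQP W K p c ∅ ε, ∃ a : ZMod p, y = a • x := by
    intro y hy
    obtain ⟨a, ha⟩ := hgen ⟨y, hy⟩
    exact ⟨a, by simpa using congrArg Subtype.val ha.symm⟩
  -- two distinct admissible primes detecting `x` (Čebotarev, twice)
  obtain ⟨q₁, -, v₁, hv₁, hdet₁⟩ :=
    exists_admQ_notMem_torsionLocalKer W K p c h5 hadd hsurj hK hH hc1 hxmem hx0' ∅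
  obtain ⟨q₂, hq₂, v₂, hv₂, hdet₂⟩ :=
    exists_admQ_notMem_torsionLocalKer W K p c h5 hadd hsurj hK hH hc1 hxmem hx0' {q₁}
  have hne : q₁ ≠ q₂ := by
    rintro rfl
    exact hq₂ (Finset.mem_singleton_self _)
  -- (J2): the level `{q₁, q₂}` has total canonical dimension one
  obtain ⟨hJε, hJε'⟩ := hJ2 ε x q₁ q₂ v₁ v₂ hxmem hx0' hline hne hv₁ hdet₁ hv₂ hdet₂
  have hrank : finrank (ZMod p) (SelQP W K p c {q₁, q₂} true) +
      finrank (ZMod p) (SelQP W K p c {q₁, q₂} false) = 1 := by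
    have h' : finrank (ZMod p) (SelQP W K p c {q₁, q₂} (!ε)) = 0 := by rw [hJε', hε0]
    cases ε
    · change finrank (ZMod p) (SelQP W K p c {q₁, q₂} true) = 0 at h'
      change finrank (ZMod p) (SelQP W K p c {q₁, q₂} false) = 1 at hJε
      omega
    · change finrank (ZMod p) (SelQP W K p c {q₁, q₂} false) = 0 at h'
      change finrank (ZMod p) (SelQP W K p c {q₁, q₂} true) = 1 at hJε
      omega
  -- the two-prime bottom, then `realisation`
  obtain ⟨m, hm⟩ := S.exists_kappa_empty_ne_zero_of_pair W K p c Dt β ι hline hbot hne hv₁ hdet₁ hrank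
  exact S.exists_kolyvaginClass_ne_zero W K p Dt β ι c hm


omit [W.IsElliptic] in
/-- **The two-prime bottom, in the currency of crux r2** (`exists_kappa_empty_ne_zero_of_pair` ∘ `realisation`): under the
hypotheses of `exists_kappa_empty_ne_zero_of_pair`, some Kolyvagin–Heegner datum of Kolyvagin-prime support has a non-zero
Kolyvagin class mod `p`. (Appended by the same seat; 2026-08-27.) [cite: WZhang2014, Thm. 4.3, Thm. 7.2, §9] -/
theorem LevelKolyvaginSystemP.exists_kolyvaginClass_ne_zero_of_pair (S : LevelKolyvaginSystemP W K p Dt β ι c)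
    {ε : Bool} {x : Vp W K p}
    (hline : ∀ y ∈ SelQP W K p c ∅ ε, ∃ a : ZMod p, y = a • x) (hbot : SelQP W K p c ∅ (!ε) = ⊥)
    {q₁ q₂ : AdmQ W K p} (hne : q₁ ≠ q₂) {v₁ : HeightOneSpectrum (𝓞 K)} (hv₁ : ((q₁ : ℕ) : 𝓞 K) ∈ v₁.asIdeal)
    (hdet : x ∉ (W.baseChange K).torsionLocalKer (v₁.adicCompletion K) ((p ^ 1 : ℕ) : ℤ))
    (hrank : finrank (ZMod p) (SelQP W K p c {q₁, q₂} true) +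
      finrank (ZMod p) (SelQP W K p c {q₁, q₂} false) = 1) :
    ∃ (n : ℕ) (d : KolyvaginHeegnerData Dt β ι n),
      KolyvaginDescent.KolSupp (Zhang2014.IsKolyvaginPrime (W.conductorNorm ℤ) W K p) n ∧
        d.kolyvaginClass (Fact.out : p.Prime) 1 ≠ 0 := by
  obtain ⟨m, hm⟩ := S.exists_kappa_empty_ne_zero_of_pair W K p c Dt β ι hline hbot hne hv₁ hdet hrank
  exact S.exists_kolyvaginClass_ne_zero W K p Dt β ι c hm

end System

end Summit.BirchSwinnertonDyer.BirchSwinnertonDyer.Theorems.AdditiveKoly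

end
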